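import Summits.BirchSwinnertonDyer.BirchSwinnertonDyer.Theorems.KatoDescentPotSupersingularWildFineSelmerSupersingularCMAnchor
import Summits.BirchSwinnertonDyer.BirchSwinnertonDyer.Theorems.KatoDescentTamePotSupersingularTameFineSelmerSupersingularUnitAnchor
import Literature.NumberTheory.EllipticCurves.FineSelmerClassGroupCriterion
import HarnessLib

/-!
# The CLASS-GROUP road to Coates–Sujatha's (A) on a row ITSELF — no anchor, no congruence: the residual
# criterion `H²(ℚ_S/ℚ, E[p]) = 0` of Deo–Ray–Sujatha (2023) in its class-number form
# (route `KatoDescentPotSupersingular`, rung K9, cell `bsd-potss`; crux item stmt-BirchSwinnertonDyer-19386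
# `WildFineSelmerCoatesSujatha`, hence the U₀ items 19189/19197; KT twin for item 19413; a
# `--supports … --as helper` file; seat `bsd-potss-k9-c4` g7; ROUTE-FREE; nothing booked, BSD is not proved
# by any of this, no item is closed)

WHY. Every road to the Conj-A crux in the tree so far needs ONE `E[3]`-congruent ANCHOR curve `E′` and the
transfer «(A) depends only on `E[p]`» (Lim–Sujatha 2018, fact p445851); the congruence `E′[3] ≅ E[3]` is a
certificate no road can prove in the kernel. Deo–Ray–Sujatha (*Pure Appl. Math. Q.* 19 (2023) no. 2,
Thm. 3.7: `H²(ℚ_S/ℚ, E[p]) = 0 ⟹` weak Leopoldt and `μ(Y(E/ℚ^cyc)) = 0`; Thm. 3.8/3.9: its class-group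
form) give a criterion for (A) INTRINSIC to the row: with `L = ℚ(E[p])`, `G = Gal(L/ℚ)`,
`S = {p} ∪ bad(E)`: (c1) `H¹(G, E[p]) = 0` — automatic when `p ∤ #G` (their Lemma 5.1; EVERY
Cartan-normaliser row at `3`: `#G ∣ 16`); (c2) `Hom_G(Cl_S(L)/p, E[p]) = 0` — implied by `p ∤ h_L`;
(c3) `E(ℚ_v)[p] = 0` at every finite `v ∈ S` — at `v = 3` EXACTLY the row test of the fine road (k9-c4 g6),
at the other bad primes a condition on the ROW. On the (t′) rows (KT, `p ∤ c_p` a theorem) (c3) is void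
whenever `p ∣ ∏ c_ℓ` (k8t-c4 g3, `…SharpRowsLocalTorsion`, p439271); on the WILD class O6 it is NOT: the
♯ rows of Kodaira type IV* at `3` with `c₃ = 3` carrying the whole `3`-part of `∏ c_ℓ` and `E(ℚ₃)[3] = 0`
(37 ♯ rows in the census of conjA-anchor g3 × k8t-c4 g6, all `3Nn`, 12 of them with NO anchor road at all)
satisfy (c3); for them (A) — hence the upper bound `ord₃ #Ш ≤ ord₃ #Ш_an` through Kato's fine reading —
follows from ONE class-number computation in the degree-16 field `ℚ(E[3])` (kit j265757 of this seat).

* §0 the printed criterion = the Literature fact `DeoRaySujatha2023.thm39_fineSelmerDual_moduleFinite_of_classNumber_divisionField`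
  (special case `p ∤ #Gal(ℚ(E[p])/ℚ)`, `p ∤ h(ℚ(E[p]))` of Thm. 3.8; stated over the tree's `divisionField`,
  `NumberField.classNumber`, `decomp`, `geomPrimaryTorsion`, and the crux's `∃`-form of (A)), hypothesis `hDRS`;
* §1 the ROW ROADS `missingUpperBoundAt_wild_of_classGroupCertificate` (K9, `p = 3`) and
  `missingUpperBoundAt_addv_of_classGroupCertificate` (KT, odd `p`) — below `hDRS`, Kato's fine reading
  `hKatoA`, GZK, modularity ONLY (no `hLS`, no bsd.S31/S28, no anchor);
* §2 the class forms `wildFineSelmerCoatesSujatha_of_classGroupCertificates` /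
  `tameFineSelmerCoatesSujatha_of_classGroupCertificates` (crux bodies from per-row class-group certificates).

Per-row certificate (data of record, NOT kernel inputs): `3 ∤ #Gal(ℚ(E[3])/ℚ)` (image in a Cartan
normaliser), `3 ∤ h(ℚ(E[3]))` (PARI `bnfinit`, GRH-conditional unless `bnfcertify`), `E(ℚ_v)[3] = 0` at
`v = 3` and at every bad `v` (division-polynomial root test). HONEST FRAMING: conditional on the displayed
named facts; class-wide the crux is Coates–Sujatha (A), a named open problem; no census number is an input.

References: [DeoRaySujatha2023] Thm. 3.7, Thm. 3.8, Thm. 3.9 (§3), Lemma 5.1–5.5, Thm. 5.6 (§5);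
[CoatesSujatha2005] §3 Conj. A, Thm. 3.4; [LimSujatha2018] §3; [Kato2004Asterisque] Thm. 14.5 (3),
Prop. 14.16 (2); [NSW2008] (8.6.10); [SerreGaloisCohomology1997] II.§5.
-/

set_option autoImplicit false
-- sibling precedent (`KatoDescentPotSupersingularAssembly.lean`): the directory name repeats the summit name
set_option linter.dupNamespace false

noncomputable section

open scoped Classical

namespace Summit.BirchSwinnertonDyer.BirchSwinnertonDyer.Theorems.WildFineSelmerClassGroupRoad

open NumberField IsDedekindDomain Field
open WeierstrassCurve Literature.NumberTheory.EllipticCurves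
  Literature.NumberTheory.EllipticCurves.GreenbergSelmer
  Literature.NumberTheory.EllipticCurves.IwasawaAlgebra
  Literature.NumberTheory.EllipticCurves.Rank1Residual
  Literature.NumberTheory.EllipticCurves.Rank1Residual.Typed
  Literature.NumberTheory.EllipticCurves.ZpExtension
  Literature.NumberTheory.GaloisRepresentations
  Summit.BirchSwinnertonDyer.Rank1Residual Summit.BirchSwinnertonDyer.Rank1Residual.Additive
  Summit.BirchSwinnertonDyer.Rank1Residual.O6
  Summit.BirchSwinnertonDyer.BirchSwinnertonDyer.Theorems

/-! ## §0 The printed criterion = the Literature fact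
`Literature.NumberTheory.EllipticCurves.DeoRaySujatha2023.thm39_fineSelmerDual_moduleFinite_of_classNumber_divisionField`
(Deo–Ray–Sujatha 2023 Thm. 3.8/3.9 (b) + Lemma 5.1, class-number special case; filed by this seat,
`Literature/NumberTheory/EllipticCurves/FineSelmerClassGroupCriterion.lean`), carried below as the
hypothesis `hDRS`. -/

/-! ## §1 The row roads: Upper at a row from its OWN class-group certificate -/

/-- **The CLASS-GROUP road, K9 row form (wild class O6 at `3`).** Let `W/ℚ` be a row of the Conj-A crux
of route K9 (globally minimal, `r_an = 0`, `ClassO6 W 3`, `W[3]` irreducible) such that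
`3 ∤ #Gal(ℚ(W[3])/ℚ)` (image in a Cartan normaliser), `3 ∤ h(ℚ(W[3]))`, and `W[3]` has no non-zero
`D_v`-fixed vector at `v = 3` and at every bad `v` (`W(ℚ_v)[3] = 0`). Then `ord₃ #Ш(W) ≤ ord₃ #Ш_an(W)`
(`MissingUpperBoundAt W 3`) — below Deo–Ray–Sujatha (`hDRS`), Kato's fine-Selmer reading (`hKatoA`),
GZK (`hGZK`) and modularity (`hmod`) only: (A) at `(W,3)` by `hDRS`, then
`WildFineSelmerSupersingularCMAnchor.missingUpperBoundAt_wild_of_conjA`. No anchor, no congruence, no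
Lim–Sujatha transfer. [cite: DeoRaySujatha2023, Thm. 3.8 and Thm. 3.9]
[cite: Kato2004Asterisque, Thm. 14.5 (3) and Prop. 14.16 (2)] [cite: CoatesSujatha2005, §3 Conjecture A] -/
theorem missingUpperBoundAt_wild_of_classGroupCertificate (hDRS : DeoRaySujatha2023.thm39_fineSelmerDual_moduleFinite_of_classNumber_divisionField)
    (hKatoA :
      Kato2004.rankZero_padicValNat_sha_add_padicValNat_tamagawa_le_of_additive_potGood_of_irreducible_of_fineSelmerDual_fg)
    (hGZK : rank_eq_analyticRank_of_analyticRank_le_one) (hmod : hasEntireLFunction_rat)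
    (W : WeierstrassCurve ℚ) [W.IsElliptic] [W.IsGloballyMinimal] [Fact (3 : ℕ).Prime]
    (hr : W.analyticRank = 0) (hO : ClassO6 W 3) (hirr : W.HasIrreducibleModPGaloisRep 3)
    (hG : ¬ 3 ∣ Nat.card ((W.divisionField 3) ≃ₐ[ℚ] (W.divisionField 3)))
    (hh : haveI : NumberField (W.divisionField 3) := NumberField.mk
      ¬ 3 ∣ NumberField.classNumber (W.divisionField 3))
    (hloc : ∀ v : HeightOneSpectrum (𝓞 ℚ), (((3 : ℕ) : 𝓞 ℚ) ∈ v.asIdeal ∨ ¬ W.HasGoodReductionAt v) →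
      ∀ x : W.geomPrimaryTorsion 3, 3 • x = 0 → (∀ d ∈ decomp v, d • x = x) → x = 0) :
    MissingUpperBoundAt W 3 :=
  WildFineSelmerSupersingularCMAnchor.missingUpperBoundAt_wild_of_conjA hKatoA hGZK hmod W hr hO hirr
    (hDRS W 3 (by norm_num) hirr hG hh hloc)

/-- **The CLASS-GROUP road, KT row form (tame classes (t′), odd `p`).** The same at an additive,
potentially good odd prime `p` (`Addv W p`, `0 ≤ v_p(j)`): `r_an = 0`, `W[p]` irreducible,
`p ∤ #Gal(ℚ(W[p])/ℚ)`, `p ∤ h(ℚ(W[p]))`, no `D_v`-fixed `p`-torsion at `v = p` and at the bad places ⟹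
`MissingUpperBoundAt W p`, via `TameFineSelmerSupersingularUnitAnchor.missingUpperBoundAt_addv_of_conjA`.
(On the (t′) rows with `p ∣ ∏ c_ℓ` the local hypothesis fails — k8t-c4 g3's `sharpRow_exists_local_pTorsion`;
it serves the rows with `p ∤ ∏ c_ℓ`, e.g. the Heegner-road rows, as an anchor-free alternative.)
[cite: DeoRaySujatha2023, Thm. 3.8 and Thm. 3.9] [cite: Kato2004Asterisque, Thm. 14.5 (3) and Prop. 14.16 (2)] -/
theorem missingUpperBoundAt_addv_of_classGroupCertificate (hDRS : DeoRaySujatha2023.thm39_fineSelmerDual_moduleFinite_of_classNumber_divisionField)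
    (hKatoA :
      Kato2004.rankZero_padicValNat_sha_add_padicValNat_tamagawa_le_of_additive_potGood_of_irreducible_of_fineSelmerDual_fg)
    (hGZK : rank_eq_analyticRank_of_analyticRank_le_one) (hmod : hasEntireLFunction_rat)
    (W : WeierstrassCurve ℚ) [W.IsElliptic] [W.IsGloballyMinimal] (p : ℕ) [Fact p.Prime]
    (hr : W.analyticRank = 0) (hp : p ≠ 2) (hA : Addv W p) (hj : 0 ≤ padicValRat p W.j)
    (hirr : W.HasIrreducibleModPGaloisRep p)
    (hG : haveI : NeZero p := ⟨(Fact.out : p.Prime).ne_zero⟩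
      ¬ p ∣ Nat.card ((W.divisionField p) ≃ₐ[ℚ] (W.divisionField p)))
    (hh : haveI : NeZero p := ⟨(Fact.out : p.Prime).ne_zero⟩
      haveI : NumberField (W.divisionField p) := NumberField.mk
      ¬ p ∣ NumberField.classNumber (W.divisionField p))
    (hloc : ∀ v : HeightOneSpectrum (𝓞 ℚ), (((p : ℕ) : 𝓞 ℚ) ∈ v.asIdeal ∨ ¬ W.HasGoodReductionAt v) →
      ∀ x : W.geomPrimaryTorsion p, p • x = 0 → (∀ d ∈ decomp v, d • x = x) → x = 0) :
    MissingUpperBoundAt W p :=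
  TameFineSelmerSupersingularUnitAnchor.missingUpperBoundAt_addv_of_conjA hKatoA hGZK hmod W p hr hp hA hj
    hirr (hDRS W p hp hirr hG hh hloc)

/-! ## §2 The crux bodies from per-row class-group certificates -/

/-- **The K9 crux body from per-row CLASS-GROUP certificates** (class form; the `hcert` currency for the
census seats): if every ♯ row of `WildFineSelmerCoatesSujatha` (item 19386) has `3 ∤ #Gal(ℚ(E[3])/ℚ)`,
`3 ∤ h(ℚ(E[3]))` and no `D_v`-fixed `3`-torsion at `v = 3` and at its bad places, the BODY of the route
decl holds verbatim — conditional on `hDRS` ONLY (no Lim–Sujatha, no anchor data). The item is NOT closed.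
[cite: DeoRaySujatha2023, Thm. 3.8 and Thm. 3.9] [cite: CoatesSujatha2005, §3 Conjecture A] -/
theorem wildFineSelmerCoatesSujatha_of_classGroupCertificates (hDRS : DeoRaySujatha2023.thm39_fineSelmerDual_moduleFinite_of_classNumber_divisionField)
    (hcert : ∀ (W : WeierstrassCurve ℚ) [W.IsElliptic] [W.IsGloballyMinimal] [Fact (3 : ℕ).Prime],
      W.analyticRank = 0 → ClassO6 W 3 → W.HasIrreducibleModPGaloisRep 3 →
      ¬ (∀ n : ℕ, W.HasSurjectiveModNGaloisRep (3 ^ n : ℕ)) → ¬ W.HasCM →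
      ¬ 3 ∣ Nat.card ((W.divisionField 3) ≃ₐ[ℚ] (W.divisionField 3)) ∧
      (haveI : NumberField (W.divisionField 3) := NumberField.mk
       ¬ 3 ∣ NumberField.classNumber (W.divisionField 3)) ∧
      (∀ v : HeightOneSpectrum (𝓞 ℚ), (((3 : ℕ) : 𝓞 ℚ) ∈ v.asIdeal ∨ ¬ W.HasGoodReductionAt v) →
        ∀ x : W.geomPrimaryTorsion 3, 3 • x = 0 → (∀ d ∈ decomp v, d • x = x) → x = 0)) :
    ∀ (W : WeierstrassCurve ℚ) [W.IsElliptic] [W.IsGloballyMinimal] [Fact (3 : ℕ).Prime],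
      W.analyticRank = 0 → ClassO6 W 3 → W.HasIrreducibleModPGaloisRep 3 →
      ¬ (∀ n : ℕ, W.HasSurjectiveModNGaloisRep (3 ^ n : ℕ)) → ¬ W.HasCM →
      ∀ (κ : ZpExtension ℚ 3), κ.IsCyclotomic →
        ∃ (γ : absoluteGaloisGroup ℚ) (D : W.FineSelmerDualData κ γ),
          Module.Finite ℤ_[3] (RestrictScalars ℤ_[3] (IwasawaAlgebra 3) D.X) := by
  intro W _ _ _ hr hO hirr hns hcm
  obtain ⟨hG, hh, hloc⟩ := hcert W hr hO hirr hns hcm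
  exact hDRS W 3 (by norm_num) hirr hG hh hloc

end Summit.BirchSwinnertonDyer.BirchSwinnertonDyer.Theorems.WildFineSelmerClassGroupRoad

end
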